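import Summits.ABC.IUTFork.Thm311Multirad
import Literature.IUT.LogThetaLattice.TensorPackets
import Literature.IUT.LogThetaLattice.ThetaPilotObjects
import Literature.IUT.LogThetaLattice.PacketLogVolumes
import Literature.IUT.LogThetaLattice.HolomorphicHull
import Mathlib.Algebra.Group.Subgroup.Lattice
import Mathlib.Order.Closure
import Mathlib.Order.WithBot
import HarnessLib

/-!
# [IUTchIII] Corollary 3.12 — the STATEMENT, verbatim form, over the landed definitions

Record-only file (D-0012) of the abc-iut cell (Cor. 3.12 crew, wave 2, seat abc-iut-c312-7; claim W2-B of
`HOME/plan/COR312-ASSIGNMENTS.md`); TAKES NO SIDE. It types the STATEMENT of [IUTchIII] Corollary 3.12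
"(Log-volume Estimates for Θ-Pilot Objects)" (S. Mochizuki, *Inter-universal Teichmüller theory III*,
kurims manuscript May 2020 = `paper:url-4b091feeb646`, statement p. 173 l. 41 – p. 174 l. 19; PRIMS **57**
(2021) pp. 597–598) OVER the typed situation of Theorem 3.11 of seat c312-1 (`Thm311.Situation`: packets
`𝓘^ℚ(^{S^±_{j+1}};^{n,∘}𝒟^⊢_{v_ℚ})` with admissible regions `Adm` and mono-analytic log-volumes `logvol` of (i) (a); the
(Ind1)/(Ind2) families) so that every noun of the printed statement is a LANDED declaration:

| printed noun [bracketed reference as printed] | resolves to (decl · owner) |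
|---|---|
| "situation of Theorem 3.11": initial Θ-data; `{^{n,m}𝓗𝓣}` from an LGP-Gaussian log-theta-lattice | `Thm311.Situation` (c312-1, B) · `LGPGaussianLogThetaLattice` (L6-t4, Def. 3.8 (iii)) |
| "procession-normalized … average over `j ∈ 𝔽_l^⋇`" [Rmk 3.1.1 (ii)–(iv); Prop 3.9 (i), (ii); Thm 3.11 (i) (a)] | `processionNormalized` (L6-t4, Prop. 3.9 (i)) over the labels `labelSucc i ∈ 𝔽_l^⋇` |
| "mono-analytic log-volume" [Prop 3.9 (ii)] | `Thm311.MRData.logvol` / `Adm` of `S.D n` (c312-1, B; → L6-t4 `Prop39ii_monoAnalyticCompat`) |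
| "holomorphic hull [Rmk 3.9.5 (i)] of the union" | `hullOfFamily` (L6-t4, Rmk. 3.9.5 (vi)) over the hull-sets of a `HullFrame`; as a closure operator `HullFrame.hullClosure` (Rmk. 3.9.5 (ii) (P1)–(P3), PROVED) |
| "possible images of a Θ-pilot object [Def 3.8 (i)], relative to the relevant Kummer isomorphisms [Thm 3.11 (ii)]" | `thetaPilotObject` (L6-t4) · glue `Setting.thetaRegionOf` (RESIDUAL R1) |
| "in the multiradial representation of Theorem 3.11, (i)" | the packets `Thm311.LogShells.Packet` (c312-1) `=` `MPacketN ℚ` (L6-t4, Prop. 3.2): `packet_eq_mpacketN` |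
| "subject to the indeterminacies (Ind1), (Ind2) [Thm 3.11 (i)]" | the subgroup generated by `Thm311.LogShells.Ind1Family ∪ Ind2Family` (c312-1, B): `Setting.indGroup` |
| "(Ind3) [Thm 3.11 (ii)]" | the `ℤ`-indexed Kummer images `m ↦ thetaRegion m`, enlarged to `thetaRegion3 = ⋃ₘ` (upper semi-compatibility = L6-t4 `Prop35ii_a`/`Prop35ii_b`) |
| "image of a q-pilot object [Def 3.8 (i)]"; the symbol "△" [[IUTchII] Cor 4.10 (i)] | `qPilotObject` (L6-t4) · glue `Setting.qRegionOf` (RESIDUAL R2; △ = L6-t2 `HodgeTheaterStrips.delta`) |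
| "`|log(q)| > 0` … computed in terms of the q-parameters of `E_F` [[IUTchI] Def 3.1 (b)] at `v ∈ 𝕍^bad`" | `AbsLogQPos`; its source `Literature.IUT.LogVolume.PilotData.deg_qPilot_pos` is wired in the companion file `Cor312StatementBridges` |
| "`−|log(Θ)| ∈ ℝ ∪ {+∞}`", "`−|log(q)| ∈ ℝ`", "`−|log(Θ)| ≥ −|log(q)|`", "i.e., `C_Θ ≥ −1` …" | `negLogTheta : WithTop ℝ`, `negLogQ : ℝ`, `Statement`, `CThetaForm` (`statement_iff_cThetaForm` PROVED in the companion `Cor312StatementBridges`) |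

RESIDUALS (placeholder → owning seat / node; the maintained table is `HOME/plan/C312-RESIDUALS.md` §1a): (R0) the
c312-1 SIGNATURES `ThetaIndex`/`LogShells`/`MRData` → instances by c312-5 `Thm311Real` over abc-iut-L5-t2
`InitialThetaData`, L6-t3 `LocalLogShells`, L4-t3 [AbsTopIII] Prop. 5.8; (R1) `Setting.thetaRegionOf` → c312-1
`Thm311LogKummer.Column` / `Thm311Pilot.PilotNouns` over L6-t4 `LGPMonoidSignature`/`VerticallyCoricLGPData`;
(R2) `Setting.qRegionOf` → idem + L6-t2 `ThetaGauLinks` ([IUTchII] Cor. 4.10 (i)); (R3) `HullFrame` → L6-t4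
`IsHullSet`/`holomorphicHull` (abstract here because c312-1's packets are the ALGEBRAIC `ℚ`-tensor products).
DICTIONARY with c312-1's `Thm311Pilot.lean` (G; the same nouns over `LatticeSituation`): `PilotNouns.hull` ←
`HullFrame.hullClosure`; `thetaRegion3` ← `Setting.thetaRegion3 = ⋃ₘ thetaRegion m`; `LogShells.IndGroup` =
`Setting.indGroup`; `Cor312At` ↔ `Statement` under `NegLogThetaReal`.

Modelling notes. (1) Volumes of HULLS only: both printed quantities are log-volumes of hull-sets (`λ·𝒪 ∈ 𝕄(−)`:
`Setting.hul_adm`); "if `U` is not relatively compact … the holomorphic hull of `U` [is] `𝓘^ℚ((−))`" (Rmk. 3.9.5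
(i)) is rendered by the value `⊤ = +∞` of `thetaLocal` — how "`−|log(Θ)| ∈ ℝ ∪ {+∞}`" arises. (2) The UNION of
possible images is taken per `(j, v_ℚ)`, as the proof's `^{n,∘}𝒰_{j,v_ℚ}` (p. 174 l. 50–58). (3) Global sums over
`v_ℚ ∈ 𝕍_ℚ` are `finsum`s (Prop. 3.9 (iii) "all but finitely many of which are zero"); finiteness of support is
`Setting.qSupport_finite` resp. part of `Setting.ThetaFinite`, so `Statement` reads no junk value. (4) Nothing
here asserts the Corollary: `Statement` is a `Prop`-valued definition [claim: Mochizuki2012, status: disputed];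
the theorems are bookkeeping. Deliberately NOT here: the proof (c312-2 `Cor312Proof.*`), Theorem 3.11 itself
(c312-1), the Dupuy–Hilado form (c312-3/c312-6), the LANA form (c312-4), any judgement.
-/

noncomputable section

namespace Summit.ABC.IUTFork.Cor312

open Thm311 Literature.IUT.LogThetaLattice

variable {T : ThetaIndex}

/-! ## 1. The multiradial carriers: c312-1's packets ARE L6-t4's mono-analytic tensor packets -/

/-- The `(j+1)`-tensor packet `log(^{S^±_{j+1}}𝒟^⊢_{v_ℚ})` of c312-1's signature is, definitionally, the
mono-analytic `n`-tensor packet `MPacketN ℚ` of [IUTchIII] Prop. 3.2 (abc-iut-L6-t4) with index set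
`A = S^±_{j+1}`: the "multiradial representation of Theorem 3.11, (i)" quoted by Cor. 3.12 lives on ONE
object for both crews. [folklore] -/
theorem packet_eq_mpacketN (L : LogShells T) (j : T.Label) (vQ : T.VQ) :
    L.Packet j vQ = MPacketN ℚ (fun (_ : T.Caps j) (v : T.Fibre vQ) => L.carrier v.1) := rfl

/-! ## 2. Hull-sets on a packet and the holomorphic hull as a closure operator -/

/-- The HULL data on one tensor packet `X = 𝓘^ℚ(^{S^±_{j+1}};^{n,∘}𝒟^⊢_{v_ℚ})` (on its ambient module): the
HULL-SETS `λ·𝒪_{(−)}` "relative to the arithmetic holomorphic structure labeled `n,∘`" ([IUTchIII] Rmk. 3.9.5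
(i), p. 127; proof of Cor. 3.12 p. 174 l. 64 – p. 175 l. 1) and the RELATIVELY COMPACT subsets (Rmk. 3.9.5
(i): the hull of a non-relatively-compact `U` is everything), with the printed well-definedness. In the
intended model the hull-sets are the `IsHullSet`s / `holomorphicHull`s of `HolomorphicHull.lean` (abc-iut-L6-t4)
for the fields decomposition of Prop. 3.1 (i) transported by Prop. 3.2 (i); abstract here (RESIDUAL R3).
[claim: Mochizuki2012, status: disputed] -/
structure HullFrame (X : Type) : Type where
  /-- `Hul`: the hull-sets `λ·𝒪_{(−)}` of Rmk. 3.9.5 (i)/(ii) -/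
  Hul : Set (Set X)
  /-- "relatively compact" (Rmk. 3.9.5 (i)) -/
  IsBounded : Set X → Prop
  /-- "admits a holomorphic hull": the condition under which "the smallest subset of the form `λ·𝒪_{(−)}`
  that contains `U`" EXISTS — L6-t4's hypothesis `FiniteLogVol` of `holomorphicHull_isHullSet` (Rmk. 3.9.5
  (i) p. 127 "contains a relatively compact subset whose log-volume … is finite"; it fails for `U` inside
  a coordinate hyperplane of `⊕_i k_i`, e.g. `U = ∅`, where no least `λ·𝒪 ⊇ U` exists since `λϖ𝒪 ⊊ λ𝒪`) -/
  HasHull : Set X → Prop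
  /-- hull-sets are relatively compact (they are compact: `λ·𝒪`) -/
  hul_bounded : ∀ H ∈ Hul, IsBounded H
  /-- a subset of a relatively compact set is relatively compact -/
  bounded_mono : ∀ U U' : Set X, U ⊆ U' → IsBounded U' → IsBounded U
  /-- a relatively compact subset lies in SOME hull-set (a large box `λ·𝒪`) -/
  exists_hul : ∀ U : Set X, IsBounded U → ∃ H ∈ Hul, U ⊆ H
  /-- well-definedness of the holomorphic hull (Rmk. 3.9.5 (i) "One verifies immediately that the
  holomorphic hull is well-defined"; L6-t4 `holomorphicHull_isHullSet`): for a relatively compact subset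
  admitting a hull, the intersection of all hull-sets containing it is again a hull-set -/
  hull_mem : ∀ U : Set X, IsBounded U → HasHull U → (⋂₀ {H | H ∈ Hul ∧ U ⊆ H}) ∈ Hul

namespace HullFrame

variable {X : Type} (F : HullFrame X)

open scoped Classical in
/-- The **holomorphic hull** of a subset ([IUTchIII] Rmk. 3.9.5 (i), p. 127: "the smallest subset of the form
`λ·𝒪_{(−)}` that contains `U`" for relatively compact `U`, "`𝓘^ℚ((−))`" otherwise): the intersection of the
hull-sets containing `U` (a hull-set whenever `U` admits a hull, `hull_mem_of_hasHull`; on bounded families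
it is L6-t4's `hullOfFamily`, Rmk. 3.9.5 (vi), see `hull_eq_hullOfFamily`), resp. everything.
[claim: Mochizuki2012, status: disputed] -/
def hull (U : Set X) : Set X :=
  if F.IsBounded U then ⋂₀ {H | H ∈ F.Hul ∧ U ⊆ H} else Set.univ

/-- `U ⊆ hull U` ("… that contains `U`"). [folklore] -/
theorem subset_hull (U : Set X) : U ⊆ F.hull U := by
  unfold hull
  split_ifs
  · exact Set.subset_sInter fun H hH => hH.2
  · exact Set.subset_univ _

/-- The hull of a relatively compact subset admitting a hull is a hull-set (well-definedness, Rmk. 3.9.5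
(i)). [folklore] -/
theorem hull_mem_of_hasHull {U : Set X} (h : F.IsBounded U) (hh : F.HasHull U) : F.hull U ∈ F.Hul := by
  unfold hull; rw [if_pos h]; exact F.hull_mem U h hh

/-- A hull-set containing `U` contains `hull U` ("smallest"). [folklore] -/
theorem hull_subset_of_mem {U H : Set X} (hH : H ∈ F.Hul) (hUH : U ⊆ H) : F.hull U ⊆ H := by
  unfold hull
  rw [if_pos (F.bounded_mono U H hUH (F.hul_bounded H hH))]
  exact Set.sInter_subset_of_mem ⟨hH, hUH⟩

/-- The hull of a relatively compact subset is relatively compact (it lies in a hull-set). [folklore] -/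
theorem hull_bounded {U : Set X} (h : F.IsBounded U) : F.IsBounded (F.hull U) := by
  obtain ⟨H, hH, hUH⟩ := F.exists_hul U h
  exact F.bounded_mono _ H (F.hull_subset_of_mem hH hUH) (F.hul_bounded H hH)

/-- The hull is monotone ((P3) of Rmk. 3.9.5 (ii)). [folklore] -/
theorem hull_mono {U U' : Set X} (h : U ⊆ U') : F.hull U ⊆ F.hull U' := by
  by_cases h' : F.IsBounded U'
  · unfold hull
    rw [if_pos h', if_pos (F.bounded_mono U U' h h')]
    exact Set.sInter_subset_sInter fun H hH => ⟨hH.1, h.trans hH.2⟩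
  · unfold hull; rw [if_neg h']; exact Set.subset_univ _

/-- The hull is idempotent ((P1) of Rmk. 3.9.5 (ii): `φ(H) = H` on hull-sets). [folklore] -/
theorem hull_hull (U : Set X) : F.hull (F.hull U) = F.hull U := by
  refine Set.Subset.antisymm ?_ (F.subset_hull _)
  by_cases h : F.IsBounded U
  · have hU : F.hull U = ⋂₀ {H | H ∈ F.Hul ∧ U ⊆ H} := by unfold hull; rw [if_pos h]
    intro x hx
    rw [hU]
    exact Set.mem_sInter.2 fun H hH =>
      F.hull_subset_of_mem hH.1 (F.hull_subset_of_mem hH.1 hH.2) hx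
  · have hu : F.hull U = Set.univ := by unfold hull; rw [if_neg h]
    rw [hu]; exact Set.subset_univ _

/-- The holomorphic hull as a CLOSURE OPERATOR on subsets of the packet — the hull map `φ` of [IUTchIII]
Rmk. 3.9.5 (ii) characterised by (P1)–(P3) (cf. L6-t4 `IsHullMap`, `hullMap_eq_sInter`); this is the slot
`Thm311.PilotNouns.hull` of c312-1's file G. PROVED from the frame axioms. [claim: Mochizuki2012, status: disputed] -/
def hullClosure : ClosureOperator (Set X) :=
  ClosureOperator.mk' F.hull (fun _ _ h => F.hull_mono h) F.subset_hull fun U => (F.hull_hull U).le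

/-- On a bounded family the hull of the union IS L6-t4's `hullOfFamily` over the hull-sets. [folklore] -/
theorem hull_eq_hullOfFamily (𝒰 : Set (Set X)) (h : F.IsBounded (⋃₀ 𝒰)) :
    F.hull (⋃₀ 𝒰) = hullOfFamily F.Hul (fun U : 𝒰 => (U : Set X)) := by
  unfold hull; rw [if_pos h]
  ext x
  simp only [hullOfFamily, Set.mem_sInter, Set.mem_setOf_eq, Set.sUnion_subset_iff, Subtype.forall]

end HullFrame

/-! ## 3. The setting: pilot objects and their (possible) images in the multiradial representation -/

/-- The SETTING of Cor. 3.12 ("Suppose that we are in the situation of Theorem 3.11", p. 173 l. 41) over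
c312-1's `S : Thm311.Situation T`: the column `n`; the LGP-Gaussian log-theta-lattice (Def. 3.8 (iii), L6-t4
`LGPGaussianLogThetaLattice`); the Prop. 3.7 output `GlobalLGPFrobenioidSignature` with `SplittingMonoids`, whence
the Θ-PILOT OBJECT `thetaPilotObject` (Def. 3.8 (i), L6-t4); the q-pilot data `QPilotData` of `†𝒞^⊩_△` ([IUTchII]
Cor. 4.10 (i): "△" = "identifying the labels `0` and `⟨𝔽_l^⋇⟩`"), whence the q-PILOT OBJECT `qPilotObject`; a hull
frame (§2) on every packet whose hull-sets are admissible; and the two GLUE maps object ↦ region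
`thetaRegionOf m` (through the Kummer isomorphisms of Thm. 3.11 (ii) at `(n, m)`; `m ∈ ℤ` because (Ind3) is
their variation in `m`, p. 156) and `qRegionOf` (for `†𝒞^⊩_△` at `(n, 0)`, "which we do *not* regard as subject
to (Ind1), (Ind2), (Ind3)"). The fields `HT`/`LogLink`/`IsFull`/`lattice` and `realify` are CONTEXT ONLY (the
printed "situation"; the two quantities read `S.D n`, `frame`, the glue maps and the pilot objects).
RESIDUALS R1/R2/R3 (module docstring). [claim: Mochizuki2012, status: disputed] -/
structure Setting {T : ThetaIndex} (S : Situation T) : Type 1 where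
  /-- the column `n ∈ ℤ` whose vertically coric data `^{n,∘}(−) = S.D n` carries the multiradial representation -/
  n : ℤ
  /-- the Θ^{±ell}NF-Hodge theaters (type of) — [IUTchI] Def. 6.13 (abc-iut-L5-t4) -/
  HT : Type
  /-- log-links between theaters — [IUTchIII] Def. 1.1 (abc-iut-L6-t3) -/
  LogLink : HT → HT → Type
  /-- "full log-link" — [IUTchIII] Def. 1.1 (iii) -/
  IsFull : ∀ {s t : HT}, LogLink s t → Prop
  /-- the LGP-Gaussian log-theta-lattice `{^{n,m}𝓗𝓣}_{n,m∈ℤ}` (Def. 3.8 (iii)) -/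
  lattice : LGPGaussianLogThetaLattice LogLink IsFull
  /-- Frobenioids (type of) — [FrdI] (abc-iut-L1) -/
  Frd : Type
  /-- isomorphisms of Frobenioids -/
  IsoF : Frd → Frd → Type
  /-- objects of a Frobenioid -/
  Ob : Frd → Type
  /-- realification — [FrdI] Prop. 5.3 -/
  realify : Frd → Frd
  /-- `𝓕^⊩`-prime-strips (type of) — [IUTchII] Def. 4.9 (abc-iut-L6-t2) -/
  Strip : Type
  /-- isomorphisms of `𝓕^⊩`-prime-strips -/
  IsoS : Strip → Strip → Type
  /-- the lgp-monoids `Ψ_{𝓕_lgp}(†𝓗𝓣)_v` at `v ∈ 𝕍^bad` (Prop. 3.4 (ii), 3.5) -/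
  M : ∀ v : T.V, v ∈ T.Vbad → Type
  /-- … are monoids -/
  [instM : ∀ v h, Monoid (M v h)]
  /-- the output of Prop. 3.7 for `†𝓗𝓣 = ^{n,m}𝓗𝓣` (global realified LGP- and lgp-Frobenioids, embeddings,
  object-forming algorithm) — L6-t4 `GlobalLGPFrobenioidSignature` -/
  sig : GlobalLGPFrobenioidSignature T.lstar T.V (· ∈ T.Vbad) Frd IsoF Ob realify Strip IsoS M
  /-- the splitting monoids `Ψ^⊥_{𝓕_lgp}(†𝓗𝓣)_v` with generators up to torsion (Def. 3.8 (i)) -/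
  split : SplittingMonoids M
  /-- objects of the global realified Frobenioid `†𝒞^⊩_△` of [IUTchII] Cor. 4.10 (i) (abc-iut-L6-t2) -/
  ObΔ : Type
  /-- the splitting monoids of `†𝓕^⊢_{△,v}`, `v ∈ 𝕍^bad` -/
  N : ∀ v : T.V, v ∈ T.Vbad → Type
  /-- … are monoids -/
  [instN : ∀ v h, Monoid (N v h)]
  /-- the q-pilot data: the `q_v`, generators up to torsion, the object-forming map (Def. 3.8 (i)) -/
  qData : QPilotData ObΔ N
  /-- the hull frame "labeled `n,∘`" on each packet (§2; RESIDUAL R3) -/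
  frame : ∀ (j : T.Label) (vQ : T.VQ), HullFrame (S.L.Packet j vQ)
  /-- hull-sets are admissible regions of (i) (a): `λ·𝒪 ∈ 𝕄(𝓘^ℚ(−))` (compact open / compact closure of open) -/
  hul_adm : ∀ j vQ, ∀ H ∈ (frame j vQ).Hul, (S.D n).Adm j vQ H
  /-- GLUE (RESIDUAL R1): object of `†𝒞^⊩_lgp` at `(n,m)` ↦ its region in `𝓘^ℚ(^{S^±_{j+1}};^{n,∘}𝒟^⊢_{v_ℚ})` via the
  Kummer isomorphisms of Thm. 3.11 (ii) at `(n,m)` [(Ind3) = variation in `m`] -/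
  thetaRegionOf : ℤ → Ob sig.Clgp → ∀ (j : T.Label) (vQ : T.VQ), Set (S.L.Packet j vQ)
  /-- GLUE (RESIDUAL R2): object of `†𝒞^⊩_△` at `(n,0)` ↦ its region, via the Kummer isomorphisms of
  Thm. 3.11 (ii) [(iii) (a): the `𝔽^{⋊±}_l`-symmetry identifies `^{n,m}𝓕^{⊢×μ}_△ ≅ 𝓕^{⊢×μ}_△(^{n,∘}𝒟^⊢_△)`] -/
  qRegionOf : ObΔ → ∀ (j : T.Label) (vQ : T.VQ), Set (S.L.Packet j vQ)
  /-- the q-pilot image is a hull-set at every `(j, v_ℚ)` (an arithmetic line bundle: Rmk. 3.9.5 (ix)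
  (cQ3); at `v ∉ 𝕍^bad` the trivial one) -/
  qRegion_mem : ∀ j vQ, qRegionOf (qPilotObject qData) j vQ ∈ (frame j vQ).Hul
  /-- Prop. 3.9 (iii) / Rmk. 3.9.7 (i): for each label, the q-pilot image has zero log-volume at all but
  finitely many `v_ℚ` -/
  qSupport_finite : ∀ j : T.Label,
    (Function.support fun vQ => (S.D n).logvol j vQ (qRegionOf (qPilotObject qData) j vQ)).Finite

attribute [instance] Setting.instM Setting.instN

namespace Setting

variable {S : Situation T} (P : Setting S)

/-- **The Θ-pilot object** of Def. 3.8 (i) in this setting — L6-t4's `thetaPilotObject` on the Prop. 3.7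
output and splitting monoids of `P`. [claim: Mochizuki2012, status: disputed] -/
def thetaPilot : P.Ob P.sig.Clgp := thetaPilotObject P.sig P.split

/-- **The q-pilot object** of Def. 3.8 (i) — L6-t4's `qPilotObject` on the q-pilot data of `P`.
[claim: Mochizuki2012, status: disputed] -/
def qPilot : P.ObΔ := qPilotObject P.qData

/-- The image at `(j, v_ℚ)`, via the Kummer isomorphisms at lattice position `(n, m)`, of the Θ-pilot object
(Thm. 3.11 (ii); one region per `m ∈ ℤ`). [claim: Mochizuki2012, status: disputed] -/
def thetaRegion (m : ℤ) (j : T.Label) (vQ : T.VQ) : Set (S.L.Packet j vQ) :=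
  P.thetaRegionOf m P.thetaPilot j vQ

/-- The (Ind3)-ENLARGED Θ-pilot region at `(j, v_ℚ)`: the union over `m ∈ ℤ` of the Kummer images ((Ind3),
p. 156: "as one varies `m ∈ ℤ`, the isomorphisms of (a) are 'upper semi-compatible'" — only the union is
invariantly defined; Dupuy–Hilado's `(O_𝕃(−P_Θ))^{Ind3}`; the slot `PilotNouns.thetaRegion3` of c312-1's G).
[claim: Mochizuki2012, status: disputed] -/
def thetaRegion3 (j : T.Label) (vQ : T.VQ) : Set (S.L.Packet j vQ) := ⋃ m : ℤ, P.thetaRegion m j vQ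

/-- The image at `(j, v_ℚ)` of the q-pilot object, "which we do *not* regard as subject to the
indeterminacies (Ind1), (Ind2), (Ind3)" (Cor. 3.12, p. 174 l. 8–10). [claim: Mochizuki2012, status: disputed] -/
def qRegion (j : T.Label) (vQ : T.VQ) : Set (S.L.Packet j vQ) := P.qRegionOf P.qPilot j vQ

/-- The indeterminacies (Ind1), (Ind2) "acting on" the multiradial representation: the subgroup of
packet-automorphism families GENERATED by c312-1's `Ind1Family ∪ Ind2Family` (Thm. 3.11 (i), p. 154; the same
`Subgroup.closure` as `LogShells.IndGroup` of c312-1's file G). [claim: Mochizuki2012, status: disputed] -/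
def indGroup (S : Situation T) : Subgroup (∀ (j : T.Label) (vQ : T.VQ), S.L.Packet j vQ ≃ₗ[ℚ] S.L.Packet j vQ) :=
  Subgroup.closure (S.L.Ind1Family ∪ S.L.Ind2Family)

/-- **The possible images of a Θ-pilot object** at `(j, v_ℚ)` "relative to the relevant Kummer isomorphisms
[cf. Theorem 3.11, (ii)], in the multiradial representation of Theorem 3.11, (i), which we regard as subject
to the indeterminacies (Ind1), (Ind2), (Ind3) described in Theorem 3.11, (i), (ii)" (Cor. 3.12, p. 173 l. 49 –
p. 174 l. 3; the proof's `^{n,∘}𝒰_{j,v_ℚ}` is the hull of the union of this family, p. 174 l. 50–58): the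
translates of the (Ind3)-enlarged region by the group generated by (Ind1), (Ind2).
[claim: Mochizuki2012, status: disputed] -/
def possibleImages (j : T.Label) (vQ : T.VQ) : Set (Set (S.L.Packet j vQ)) :=
  {U | ∃ Φ ∈ indGroup S, U = Φ j vQ '' P.thetaRegion3 j vQ}

/-- The (Ind3)-enlarged region is itself a possible image (identity indeterminacy). [folklore] -/
theorem thetaRegion3_mem_possibleImages (j : T.Label) (vQ : T.VQ) :
    P.thetaRegion3 j vQ ∈ P.possibleImages j vQ :=
  ⟨1, (indGroup S).one_mem, by simp⟩

/-- `^{n,∘}𝒰_{j,v_ℚ}`: the holomorphic hull of the union of the possible images (proof of Cor. 3.12, p. 174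
l. 50 – p. 175 l. 1). [claim: Mochizuki2012, status: disputed] -/
def thetaHull (j : T.Label) (vQ : T.VQ) : Set (S.L.Packet j vQ) :=
  (P.frame j vQ).hull (⋃₀ P.possibleImages j vQ)

/-! ## 4. The two printed quantities -/

/-- The union of the possible images at `(j, v_ℚ)` "admits its holomorphic hull": it is relatively compact
(so the printed hull is not `𝓘^ℚ((−))`) and non-degenerate (`HullFrame.HasHull`, so "the smallest `λ·𝒪`
containing" it exists and `thetaHull j vQ` is a hull-set, hence admissible). [claim: Mochizuki2012, status: disputed] -/
def HullDefined (j : T.Label) (vQ : T.VQ) : Prop :=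
  (P.frame j vQ).IsBounded (⋃₀ P.possibleImages j vQ) ∧ (P.frame j vQ).HasHull (⋃₀ P.possibleImages j vQ)

/-- Under `HullDefined`, `^{n,∘}𝒰_{j,v_ℚ}` is a hull-set, hence an admissible region of (i) (a). [folklore] -/
theorem thetaHull_adm {j : T.Label} {vQ : T.VQ} (h : P.HullDefined j vQ) :
    (S.D P.n).Adm j vQ (P.thetaHull j vQ) :=
  P.hul_adm j vQ _ ((P.frame j vQ).hull_mem_of_hasHull h.1 h.2)

open scoped Classical in
/-- The local contribution at `(j, v_ℚ)` to `−|log(Θ)|`: the mono-analytic log-volume (`(S.D n).logvol`, Thm.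
3.11 (i) (a)) of the holomorphic hull of the union of the possible images when that hull is defined
(`HullDefined`: the log-volume is then read on an admissible region, `thetaHull_adm`), and `+∞` otherwise —
the printed case "not relatively compact" (hull `= 𝓘^ℚ((−))`, infinite log-volume) together with the
degenerate case in which the printed "smallest `λ·𝒪` containing `U`" does not exist.
[claim: Mochizuki2012, status: disputed] -/
def thetaLocal (j : T.Label) (vQ : T.VQ) : WithTop ℝ :=
  if P.HullDefined j vQ then (((S.D P.n).logvol j vQ (P.thetaHull j vQ) : ℝ) : WithTop ℝ) else ⊤

/-- The local contribution at `(j, v_ℚ)` to `−|log(q)|`: the mono-analytic log-volume of the image of the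
q-pilot object (a hull-set, `qRegion_mem`, hence admissible, `hul_adm`). [claim: Mochizuki2012, status: disputed] -/
def qLocal (j : T.Label) (vQ : T.VQ) : ℝ := (S.D P.n).logvol j vQ (P.qRegion j vQ)

/-- The nonzero label `j = i + 1 ∈ 𝔽_l^⋇ = {1, …, l^⋇}` with index `i : Fin l^⋇` (the average of Cor. 3.12 is
"taken over `j ∈ 𝔽_l^⋇`"; c312-1's `ThetaIndex.LabelStar` are these labels). [folklore] -/
def labelSucc (i : Fin T.lstar) : T.Label := i.succ

/-- `labelSucc i ≠ 0`. [folklore] -/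
theorem labelSucc_ne_zero (i : Fin T.lstar) : (labelSucc i : T.Label) ≠ 0 := Fin.succ_ne_zero i

/-- "the quantity `−|log(Θ)|` is finite" (proof of Cor. 3.12, p. 175 l. 2–4: "one concludes easily from the
[easily verified] compactness of the `^{1,∘}𝒰_{j,v_ℚ}` …"): every union of possible images at a label in `𝔽_l^⋇`
is relatively compact and admits its hull (`thetaLocal ≠ ⊤`), and (Prop. 3.9 (iii)) the hull-volumes vanish at
all but finitely many `v_ℚ`. [claim: Mochizuki2012, status: disputed] -/
@[claim "Mochizuki2012" "disputed"] def ThetaFinite : Prop :=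
  (∀ (i : Fin T.lstar) (vQ : T.VQ), P.thetaLocal (labelSucc i) vQ ≠ ⊤) ∧
    ∀ i : Fin T.lstar, (Function.support fun vQ => (P.thetaLocal (labelSucc i) vQ).untopD 0).Finite

open scoped Classical in
/-- **`−|log(Θ)| ∈ ℝ ∪ {+∞}`** (Cor. 3.12, p. 173 l. 43 – p. 174 l. 3): "the procession-normalized mono-analytic
log-volume [i.e., where the average is taken over `j ∈ 𝔽_l^⋇` — cf. Remark 3.1.1, (ii), (iii), (iv);
Proposition 3.9, (i), (ii); Theorem 3.11, (i), (a)] of the holomorphic hull [cf. Remark 3.9.5, (i)] of the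
union of the possible images of a Θ-pilot object [cf. Definition 3.8, (i)], relative to the relevant Kummer
isomorphisms [cf. Theorem 3.11, (ii)], in the multiradial representation of Theorem 3.11, (i), which we
regard as subject to the indeterminacies (Ind1), (Ind2), (Ind3) described in Theorem 3.11, (i), (ii)":
`processionNormalized` (L6-t4, Prop. 3.9 (i)) of the global sums (Prop. 3.9 (iii)) of `thetaLocal`;
`⊤ = +∞` unless `ThetaFinite`. [claim: Mochizuki2012, status: disputed] -/
def negLogTheta : WithTop ℝ :=
  if P.ThetaFinite then
    ((processionNormalized fun i : Fin T.lstar =>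
        ∑ᶠ vQ : T.VQ, (P.thetaLocal (labelSucc i) vQ).untopD 0 : ℝ) : WithTop ℝ)
  else ⊤

/-- **`−|log(q)| ∈ ℝ`** (Cor. 3.12, p. 174 l. 4–10): "the procession-normalized mono-analytic log-volume of the
image of a q-pilot object [cf. Definition 3.8, (i)], relative to the relevant Kummer isomorphisms [cf.
Theorem 3.11, (ii)], in the multiradial representation of Theorem 3.11, (i), which we do *not* regard as
subject to the indeterminacies (Ind1), (Ind2), (Ind3)". [claim: Mochizuki2012, status: disputed] -/
def negLogQ : ℝ :=
  processionNormalized fun i : Fin T.lstar => ∑ᶠ vQ : T.VQ, P.qLocal (labelSucc i) vQ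

/-- `|log(q)|`, the absolute value of `−|log(q)|` (notation of Cor. 3.12). [claim: Mochizuki2012, status: disputed] -/
def absLogQ : ℝ := |P.negLogQ|

/-! ## 5. The statement -/

/-- **[IUTchIII] Corollary 3.12 (Log-volume Estimates for Θ-Pilot Objects)**, conclusion as printed (p. 174
l. 16–18): "Then it holds that `−|log(Θ)| ∈ ℝ`, and `−|log(Θ)| ≥ −|log(q)|`". A `Prop`-valued definition over the
setting `P`; NOT asserted anywhere in the tree. [claim: Mochizuki2012, status: disputed] -/
@[claim "Mochizuki2012" "disputed"] def Statement : Prop :=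
  P.negLogTheta ≠ ⊤ ∧ ((P.negLogQ : ℝ) : WithTop ℝ) ≤ P.negLogTheta

/-- The printed rephrasing (p. 174 l. 18–19): "— i.e., `C_Θ ≥ −1` for any real number `C_Θ ∈ ℝ` such that
`−|log(Θ)| ≤ C_Θ · |log(q)|`" (with `−|log(Θ)| ∈ ℝ`). [claim: Mochizuki2012, status: disputed] -/
@[claim "Mochizuki2012" "disputed"] def CThetaForm : Prop :=
  P.negLogTheta ≠ ⊤ ∧ ∀ C : ℝ, P.negLogTheta ≤ ((C * P.absLogQ : ℝ) : WithTop ℝ) → -1 ≤ C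

/-- "In particular, `|log(q)| > 0`" (p. 174 l. 13), typed under the intended sign `−|log(q)| ≤ 0` as
`−|log(q)| < 0` — the positivity the `C_Θ`-rephrasing and the proof's opening reduction use (its source in the
q-parameters: companion file `Cor312StatementBridges`). [claim: Mochizuki2012, status: disputed] -/
@[claim "Mochizuki2012" "disputed"] def AbsLogQPos : Prop := P.negLogQ < 0

end Setting

end Summit.ABC.IUTFork.Cor312

end
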